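import Summits.NavierStokesRegularity.NavierStokesRegularity.Theorems.StrainDoorsAlgebra
import Literature.Analysis.FluidPDE.ParabolicComparison
import Literature.Analysis.FluidPDE.EnstrophySplitting
import HarnessLib

/-!
# StrainDoorsGrowth — door family S37 «StrainDoors» (nsreg-p1 ROUND-35), plate E1_S «StrainGrowth»

S-door lane (ns-sfl-p1 g5, first-announce 2026-08-28T18:38:20Z; LEAD ns-s30-p1 g3; texts of record nsreg-p1 g31
`r35/Sketch37.lean` sha16 265cb074f1d98fd0, `StrainGrowth` l.186; `--supports stmt-NavierStokesRegularity-0056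
--as helper`). The RICCATI LAW at a strain argmax, PDE-free: `ν ≥ 0`, `v` smooth, `|ē| = 1`, `x̄` a global maximum of
`x ↦ ⟪∇v(x) ē, ē⟫`; if `w + D((v·∇)v)(x̄)ē = ν D(Δv)(x̄)ē − D(∇q)(x̄)ē` then
`⟪w, ē⟫ ≤ −⟪∇v(x̄)ē,ē⟫² + ¼(|ω(x̄)|² − ⟪ω(x̄),ē⟫²) − ⟪D(∇q)(x̄)ē, ē⟫`. Ingredients: the product rule
`D((v·∇)v)(x̄)ē = D²v(x̄)(ē)(v(x̄)) + ∇v(∇v ē)`; Schwarz + Fermat (`D_x⟪∇v ē,ē⟫(x̄) = 0`) kill the transport term;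
the quadratic term by `neg_inner_fderiv_fderiv_le` (`StrainDoorsAlgebra`); `⟪D(Δv)(x̄)ē, ē⟫ = Δ⟪∇v ē,ē⟫(x̄) ≤ 0`
(`fderiv_laplacian_apply_of_contDiff_three`, `ContDiffAt.laplacian_CLM_comp_left`, `IsLocalMax.laplacian_nonpos`).
`strainGrowth` is the text of the plate δ-unfolded (by-name `strainGrowth_holds : StrainGrowth` once P0-37 lands).

WHAT THIS IS NOT: the engine of a regularity CRITERION (doors S37-H/Π); item 0056 `NoTypeII` and NS regularity are
NOT proved; nothing here is a route or a summit statement.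
-/

-- the summit's problem namespace repeats the summit name (tree layout)
set_option linter.dupNamespace false

noncomputable section

open Set Function Filter Topology InnerProductSpace
open scoped RealInnerProductSpace Laplacian ContDiff
open Literature.Analysis Literature.Analysis.FluidPDE VectorCalculus

namespace Summit.NavierStokesRegularity.NavierStokesRegularity.Theorems.ArgmaxDoors

-- nested operator types (second derivatives)
set_option maxSynthPendingDepth 3

/-- **Second-order condition along the Laplacian**: for smooth `v`, a fixed `e`, and `x₀` a global maximum of
`y ↦ ⟪∇v(y) e, e⟫`: `⟪D(Δv)(x₀) e, e⟫ = Δ(y ↦ ⟪∇v(y)e, e⟫)(x₀) ≤ 0`. -/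
theorem inner_fderiv_laplacian_le_zero_of_isMax {v : EuclideanSpace ℝ (Fin 3) → EuclideanSpace ℝ (Fin 3)}
    (hv : ContDiff ℝ ∞ v) (x₀ e : EuclideanSpace ℝ (Fin 3))
    (hmax : ∀ y, ⟪fderiv ℝ v y e, e⟫ ≤ ⟪fderiv ℝ v x₀ e, e⟫) :
    ⟪fderiv ℝ (Δ v) x₀ e, e⟫ ≤ 0 := by
  have hv3 : ContDiff ℝ 3 v := hv.of_le (by norm_cast)
  have hg : ContDiff ℝ 2 (fun y => fderiv ℝ v y e) :=
    ((hv.of_le (by norm_cast : (3 : WithTop ℕ∞) ≤ ∞)).fderiv_right (m := 2) (by norm_cast)).clm_apply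
      contDiff_const
  rw [fderiv_laplacian_apply_of_contDiff_three hv3 x₀ e, real_inner_comm]
  -- `⟪e, Δg(x₀)⟫ = Δ(⟪e, g⟫)(x₀)`
  have h1 : ⟪e, Δ (fun y => fderiv ℝ v y e) x₀⟫ = Δ (fun y => ⟪e, fderiv ℝ v y e⟫) x₀ := by
    have h := (hg.contDiffAt (x := x₀)).laplacian_CLM_comp_left (l := innerSL ℝ e)
    exact h.symm
  rw [h1]
  have hW : ContDiff ℝ 2 (fun y => ⟪e, fderiv ℝ v y e⟫) := (innerSL ℝ e).contDiff.comp hg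
  refine IsLocalMax.laplacian_nonpos hW (Filter.Eventually.of_forall fun y => ?_)
  show ⟪e, fderiv ℝ v y e⟫ ≤ ⟪e, fderiv ℝ v x₀ e⟫
  rw [real_inner_comm (fderiv ℝ v y e) e, real_inner_comm (fderiv ℝ v x₀ e) e]
  exact hmax y

/-- **Fermat kills the transport term**: for smooth `v`, fixed `e`, `x₀` a global maximum of `y ↦ ⟪∇v(y)e, e⟫`, and
any direction `a`: `⟪D²v(x₀)(e)(a), e⟫ = ⟪D²v(x₀)(a)(e), e⟫ = D_x⟪∇v e, e⟫(x₀) a = 0`. -/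
theorem inner_fderiv_fderiv_apply_eq_zero_of_isMax {v : EuclideanSpace ℝ (Fin 3) → EuclideanSpace ℝ (Fin 3)}
    (hv : ContDiff ℝ ∞ v) (x₀ e a : EuclideanSpace ℝ (Fin 3))
    (hmax : ∀ y, ⟪fderiv ℝ v y e, e⟫ ≤ ⟪fderiv ℝ v x₀ e, e⟫) :
    ⟪fderiv ℝ (fderiv ℝ v) x₀ e a, e⟫ = 0 := by
  have hv2 : ContDiff ℝ 2 v := hv.of_le (by norm_cast)
  have hD1 : ContDiff ℝ 1 (fderiv ℝ v) := hv2.fderiv_right (m := 1) (by norm_cast)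
  have hD1d : DifferentiableAt ℝ (fderiv ℝ v) x₀ := (hD1.differentiable one_ne_zero) x₀
  -- Schwarz
  have hsymm : fderiv ℝ (fderiv ℝ v) x₀ e a = fderiv ℝ (fderiv ℝ v) x₀ a e :=
    (hv2.contDiffAt.isSymmSndFDerivAt (by simp [minSmoothness_of_isRCLikeNormedField])).eq e a
  rw [hsymm]
  -- the derivative of `W y = ⟪e, ∇v(y) e⟫` at `x₀` in the direction `a`
  have hg : DifferentiableAt ℝ (fun y => fderiv ℝ v y e) x₀ := hD1d.clm_apply (differentiableAt_const e)
  have hW : HasFDerivAt (fun y => ⟪e, fderiv ℝ v y e⟫)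
      ((innerSL ℝ e).comp (fderiv ℝ (fun y => fderiv ℝ v y e) x₀)) x₀ :=
    (innerSL ℝ e).hasFDerivAt.comp x₀ hg.hasFDerivAt
  have hmax' : IsLocalMax (fun y => ⟪e, fderiv ℝ v y e⟫) x₀ :=
    Filter.Eventually.of_forall fun y => by
      show ⟪e, fderiv ℝ v y e⟫ ≤ ⟪e, fderiv ℝ v x₀ e⟫
      rw [real_inner_comm (fderiv ℝ v y e) e, real_inner_comm (fderiv ℝ v x₀ e) e]; exact hmax y
  have h0 := hmax'.hasFDerivAt_eq_zero hW
  have h0a := congrArg (fun L : EuclideanSpace ℝ (Fin 3) →L[ℝ] ℝ => L a) h0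
  simp only [ContinuousLinearMap.coe_comp, comp_apply, innerSL_apply_apply, zero_apply] at h0a
  rw [fderiv_apply_const_apply hD1d e a] at h0a
  rw [real_inner_comm]
  exact h0a

/-- **Plate E1_S «StrainGrowth»** (nsreg-p1 ROUND-35, `Sketch37.lean` l.186), PROVED — the text δ-unfolded: the
Riccati law at a strain argmax. `ν ≥ 0`, `v` smooth, `q` any scalar field, `|e₀| = 1`, `x₀` a global maximum of
`y ↦ ⟪∇v(y)e₀, e₀⟫`; for every `w` with `w + D((v·∇)v)(x₀)e₀ = ν D(Δv)(x₀)e₀ − D(∇q)(x₀)e₀`: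
`⟪w, e₀⟫ ≤ −⟪∇v(x₀)e₀,e₀⟫² + ¼(‖curl v(x₀)‖² − ⟪curl v(x₀),e₀⟫²) − ⟪D(∇q)(x₀)e₀, e₀⟫`. -/
theorem strainGrowth : ∀ (ν : ℝ), 0 ≤ ν →
    ∀ (v : (EuclideanSpace ℝ (Fin 3)) → (EuclideanSpace ℝ (Fin 3))) (q : (EuclideanSpace ℝ (Fin 3)) → ℝ),
      ContDiff ℝ ∞ v →
      ∀ (x₀ e₀ : EuclideanSpace ℝ (Fin 3)), ‖e₀‖ = 1 →
        (∀ y, ⟪fderiv ℝ v y e₀, e₀⟫ ≤ ⟪fderiv ℝ v x₀ e₀, e₀⟫) →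
        ∀ w : EuclideanSpace ℝ (Fin 3),
          w + fderiv ℝ (convect v v) x₀ e₀ = ν • fderiv ℝ (Δ v) x₀ e₀ - fderiv ℝ (gradient q) x₀ e₀ →
          ⟪w, e₀⟫ ≤ -⟪fderiv ℝ v x₀ e₀, e₀⟫ ^ 2 + (1 / 4) * (‖curl v x₀‖ ^ 2 - ⟪curl v x₀, e₀⟫ ^ 2) -
            ⟪fderiv ℝ (gradient q) x₀ e₀, e₀⟫ := by
  intro ν hν v q hv x₀ e₀ he₀ hmax w hw
  have hv2 : ContDiff ℝ 2 v := hv.of_le (by norm_cast)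
  have hvd : Differentiable ℝ v := (hv.of_le (by norm_cast : (1 : WithTop ℕ∞) ≤ ∞)).differentiable one_ne_zero
  have hD1 : ContDiff ℝ 1 (fderiv ℝ v) := hv2.fderiv_right (m := 1) (by norm_cast)
  have hD1d : DifferentiableAt ℝ (fderiv ℝ v) x₀ := (hD1.differentiable one_ne_zero) x₀
  -- the product rule for the convective term
  have hconv : convect v v = fun y => fderiv ℝ v y (v y) := rfl
  have hprod : fderiv ℝ (convect v v) x₀ e₀ =
      fderiv ℝ (fderiv ℝ v) x₀ e₀ (v x₀) + fderiv ℝ v x₀ (fderiv ℝ v x₀ e₀) := by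
    rw [hconv, fderiv_clm_apply hD1d (hvd x₀)]
    simp only [add_apply, ContinuousLinearMap.coe_comp, comp_apply, ContinuousLinearMap.flip_apply]
    rw [add_comm]
  -- solve for `w`
  have hw' : w = ν • fderiv ℝ (Δ v) x₀ e₀ - fderiv ℝ (gradient q) x₀ e₀ -
      (fderiv ℝ (fderiv ℝ v) x₀ e₀ (v x₀) + fderiv ℝ v x₀ (fderiv ℝ v x₀ e₀)) := by
    rw [← hprod, ← hw]; abel
  rw [hw', inner_sub_left, inner_sub_left, inner_add_left, real_inner_smul_left,
    inner_fderiv_fderiv_apply_eq_zero_of_isMax hv x₀ e₀ (v x₀) hmax, zero_add]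
  have h1 := inner_fderiv_laplacian_le_zero_of_isMax hv x₀ e₀ hmax
  have h2 := neg_inner_fderiv_fderiv_le v x₀ e₀ he₀
  have h3 : ν * ⟪fderiv ℝ (Δ v) x₀ e₀, e₀⟫ ≤ 0 := mul_nonpos_of_nonneg_of_nonpos hν h1
  linarith

end Summit.NavierStokesRegularity.NavierStokesRegularity.Theorems.ArgmaxDoors

end
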